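import Summits.MatrixMultiplication.MatrixMultiplication.Theses.FourierTwoFamiliesModP
import Summits.MatrixMultiplication.MatrixMultiplication.Theses.EisensteinValCertificates
import Literature.Computability.AlgebraicComplexity.SimultaneousDoubleProduct
import Literature.Computability.AlgebraicComplexity.PrattTrapezoidValSTPP
import Literature.Computability.AlgebraicComplexity.PrattTrapezoidValProofs

/-!
# `PrimeTwoFamilies` (crux stmt-MatrixMultiplication-14308, route FourierTwoFamiliesModP):
# the Val transfer at PRIME moduli — checked kill criteria

Negative-side support file of the crux disprover (cdisprove seat); everything `sorry`-free.

* `exists_prime_prattVal_ge_of_primeTwoFamilies` — the crux forces `Val(ℤ/P) ≥ P^{4/3-ε}` for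
  infinitely many PRIMES `P` (Pratt 2024 Thm 4.7 at prime moduli for prime-cyclic two families: CKSU §6
  lift on a Behrend corner-free index set — tree `addSimultaneousTPP_of_sdpp`,
  `exists_cornerFree_indexMaps_card_ge` —, the tree's mixed-radix Freiman map into ANY modulus
  `N ≥ (3p)³` — `sum_card_mul_le_prattVal_zmod_of_addEquiv` — and Bertrand for a prime modulus).
* `primeTwoFamilies_false_of_primeFourThirdsSaving :
  EisensteinValCertificates.PrimeFourThirdsSaving → ¬ PrimeTwoFamilies` — the sibling route's 4/3 rung
  (stmt-MatrixMultiplication-7790) is a sufficient kill of this crux (the route text's criterion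
  "PrimeFourThirdsSaving + Pratt Thm 4.7" made precise: `pratt2024_thm47` alone gives composite moduli).
* `primeTwoFamilies_false_of_valSaving` — any saving `Val(ℤ/N) < N^{4/3-ε}` for ALL large moduli
  refutes the crux (tree theorem `pratt2024_thm47_holds`), via `twoFamiliesAbelian_of_primeTwoFamilies`.
-/

namespace Summit.MatrixMultiplication.MatrixMultiplication.Theorems.PrimeTwoFamilies.Negative

open Finset
open Summit.MatrixMultiplication.MatrixMultiplication.Theses
open Literature.Computability.AlgebraicComplexity

/-! ## §3 Conditional kill: the crux forces large `Val(ℤ/P)` at primes -/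

/-- The case `ε ≤ 1` of `exists_prime_prattVal_ge_of_primeTwoFamilies`. -/
theorem exists_prime_prattVal_ge_aux (hT : FourierTwoFamiliesModP.PrimeTwoFamilies)
    {ε : ℝ} (hε : 0 < ε) (hε1 : ε ≤ 1) (N₀ : ℕ) :
    ∃ P : ℕ, ∃ _ : NeZero P, P.Prime ∧ N₀ ≤ P ∧ (P : ℝ) ^ (4 / 3 - ε) ≤ (prattVal (ZMod P) : ℝ) := by
  have hδpos : 0 < ε / 4 := by positivity
  have hδ1 : ε / 4 ≤ 1 := by linarith
  obtain ⟨n₁, hn₁⟩ := exists_cornerFree_indexMaps_card_ge (ε / 4) hδpos hδ1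
  obtain ⟨n, hn, p, hp, A, B, hW, hX, hpn, hAB⟩ :=
    hT (ε / 4) hδpos (n₁ + ⌈Real.exp (10 / ε)⌉₊ + N₀ + 2)
  have hn1nat : 1 < n := by omega
  have hnpos : (0 : ℝ) < n := by exact_mod_cast (show 0 < n by omega)
  have hn1 : (1 : ℝ) < n := by exact_mod_cast hn1nat
  have hLpos : 0 < Real.log n := Real.log_pos hn1
  -- `ε · log n > 10`
  have hbig : 10 < ε * Real.log n := by
    have h1 : Real.exp (10 / ε) < n := by
      have h2 := Nat.le_ceil (Real.exp (10 / ε))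
      have h3 : (⌈Real.exp (10 / ε)⌉₊ : ℝ) < n := by
        exact_mod_cast (show ⌈Real.exp (10 / ε)⌉₊ < n by omega)
      linarith
    have h4 := Real.log_lt_log (Real.exp_pos _) h1
    rw [Real.log_exp, div_lt_iff₀ hε] at h4
    linarith
  haveI : Fact p.Prime := ⟨hp⟩
  have hppos : (0 : ℝ) < p := by exact_mod_cast hp.pos
  -- `N₀ ≤ n ≤ p`
  have hnp : n ≤ p := by
    have i : Fin n := ⟨0, by omega⟩
    have h1 : (A i).card * (B i).card ≤ p := by
      have := card_mul_card_le_of_dpp (H := ZMod p) (hW i)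
      rwa [ZMod.card] at this
    have h2 : (n : ℝ) ≤ (n : ℝ) ^ (2 - ε / 4) := by
      calc (n : ℝ) = (n : ℝ) ^ (1 : ℝ) := (Real.rpow_one _).symm
        _ ≤ (n : ℝ) ^ (2 - ε / 4) := Real.rpow_le_rpow_of_exponent_le hn1.le (by linarith)
    have h3 : (n : ℝ) ≤ (p : ℝ) := by
      calc (n : ℝ) ≤ (n : ℝ) ^ (2 - ε / 4) := h2
        _ ≤ (((A i).card * (B i).card : ℕ) : ℝ) := hAB i
        _ ≤ (p : ℝ) := by exact_mod_cast h1
    exact_mod_cast h3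
  -- corner-free index maps and the CKSU family in `(ℤ/p)³`
  obtain ⟨ι₀, _inst1, _inst2, j₁, j₂, j₃, hι₀, hcf⟩ := hn₁ n (by omega)
  have hS := addSimultaneousTPP_of_sdpp hW hX j₁ j₂ j₃ hcf
  -- a PRIME modulus above the mixed-radix range `(3p)³` (Bertrand)
  have hMeq : (3 ^ 1 * ∏ _i : Fin 1, p) ^ 3 = 27 * p ^ 3 := by simp; ring
  obtain ⟨P, hP, hMP, hP2M⟩ := Nat.exists_prime_lt_and_le_two_mul ((3 ^ 1 * ∏ _i : Fin 1, p) ^ 3)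
    (by rw [hMeq]; have := hp.pos; positivity)
  haveI : NeZero P := ⟨hP.ne_zero⟩
  have hPpos : (0 : ℝ) < P := by exact_mod_cast hP.pos
  have hval := sum_card_mul_le_prattVal_zmod_of_addEquiv hS (k := 1) (m := fun _ => p)
    (fun _ => hp.pos) (AddEquiv.piUnique (fun _ : Fin 1 => ZMod p)).symm (N := P) hMP.le
  rw [Finset.sum_congr rfl (fun x _ => card_mul_card_mul_card_sdpp j₁ j₂ j₃ x)] at hval
  -- `P ≥ N₀`
  have hNP : N₀ ≤ P := by
    rw [hMeq] at hMP
    have h1 : p ≤ p ^ 3 := Nat.le_self_pow (by norm_num) p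
    have h2 : p ^ 3 ≤ 27 * p ^ 3 := Nat.le_mul_of_pos_left (p ^ 3) (by norm_num)
    omega
  refine ⟨P, ⟨hP.ne_zero⟩, hP, hNP, ?_⟩
  -- lower bound of the packing sum: each term is `≥ Y³`, `Y = n^{2-ε/4}`
  set Y : ℝ := (n : ℝ) ^ (2 - ε / 4) with hY
  have hYpos : 0 < Y := Real.rpow_pos_of_pos hnpos _
  have hterm : ∀ x : ι₀, Y ^ 3 ≤
      ((#(A (j₁ x)) * #(B (j₁ x)) * (#(A (j₂ x)) * #(B (j₂ x))) * (#(A (j₃ x)) * #(B (j₃ x))) : ℕ) : ℝ) := by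
    intro x
    have h1 := hAB (j₁ x)
    have h2 := hAB (j₂ x)
    have h3 := hAB (j₃ x)
    have h12 : Y * Y ≤ (((A (j₁ x)).card * (B (j₁ x)).card : ℕ) : ℝ) *
        (((A (j₂ x)).card * (B (j₂ x)).card : ℕ) : ℝ) :=
      mul_le_mul h1 h2 hYpos.le (hYpos.le.trans h1)
    have h123 : Y * Y * Y ≤ (((A (j₁ x)).card * (B (j₁ x)).card : ℕ) : ℝ) *
        (((A (j₂ x)).card * (B (j₂ x)).card : ℕ) : ℝ) * (((A (j₃ x)).card * (B (j₃ x)).card : ℕ) : ℝ) :=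
      mul_le_mul h12 h3 hYpos.le ((mul_pos hYpos hYpos).le.trans h12)
    calc Y ^ 3 = Y * Y * Y := by ring
      _ ≤ _ := h123
      _ = _ := by push_cast; ring
  have hsum : (Fintype.card ι₀ : ℝ) * Y ^ 3 ≤ (prattVal (ZMod P) : ℝ) := by
    have h1 : ∑ _x : ι₀, Y ^ 3 ≤ ∑ x : ι₀,
        ((#(A (j₁ x)) * #(B (j₁ x)) * (#(A (j₂ x)) * #(B (j₂ x))) * (#(A (j₃ x)) * #(B (j₃ x))) : ℕ) : ℝ) :=
      Finset.sum_le_sum fun x _ => hterm x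
    rw [Finset.sum_const, Finset.card_univ, nsmul_eq_mul] at h1
    have h2 : ((∑ x : ι₀, #(A (j₁ x)) * #(B (j₁ x)) * (#(A (j₂ x)) * #(B (j₂ x))) *
        (#(A (j₃ x)) * #(B (j₃ x))) : ℕ) : ℝ) ≤ (prattVal (ZMod P) : ℝ) := by exact_mod_cast hval
    push_cast at h2
    push_cast at h1
    linarith
  -- logarithms
  have hNpos : (0 : ℝ) < Fintype.card ι₀ := by
    by_contra h0
    push Not at h0
    have h0' : (Fintype.card ι₀ : ℝ) = 0 := le_antisymm h0 (Nat.cast_nonneg _)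
    rw [h0', mul_zero] at hι₀
    exact absurd hι₀ (not_le.2 (Real.rpow_pos_of_pos hnpos _))
  have hlogN : (2 - ε / 4) * Real.log n - Real.log 64 ≤ Real.log (Fintype.card ι₀) := by
    have h1 := Real.log_le_log (Real.rpow_pos_of_pos hnpos _) hι₀
    rw [Real.log_rpow hnpos, Real.log_mul (by norm_num) hNpos.ne'] at h1
    linarith
  have hVpos : (0 : ℝ) < prattVal (ZMod P) := lt_of_lt_of_le (mul_pos hNpos (pow_pos hYpos 3)) hsum
  have hlogV : Real.log (Fintype.card ι₀) + 3 * ((2 - ε / 4) * Real.log n) ≤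
      Real.log (prattVal (ZMod P)) := by
    have h1 := Real.log_le_log (mul_pos hNpos (pow_pos hYpos 3)) hsum
    rw [Real.log_mul hNpos.ne' (pow_pos hYpos 3).ne', Real.log_pow, hY, Real.log_rpow hnpos] at h1
    push_cast at h1
    linarith
  have hlogP : Real.log P ≤ Real.log 54 + 3 * ((2 + ε / 4) * Real.log n) := by
    have hPle : (P : ℝ) ≤ 54 * (p : ℝ) ^ 3 := by
      rw [hMeq] at hP2M
      have : (P : ℝ) ≤ ((2 * (27 * p ^ 3) : ℕ) : ℝ) := by exact_mod_cast hP2M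
      push_cast at this
      linarith
    have h1 := Real.log_le_log hPpos hPle
    rw [Real.log_mul (by norm_num) (pow_pos hppos 3).ne', Real.log_pow] at h1
    have h2 : Real.log p ≤ (2 + ε / 4) * Real.log n := by
      have := Real.log_le_log hppos hpn
      rwa [Real.log_rpow hnpos] at this
    push_cast at h1
    linarith
  -- numerics: `log 54 ≤ log 64 = 6 log 2 < 4.16`
  have hlog64 : Real.log 64 < 4.16 := by
    have : Real.log 64 = 6 * Real.log 2 := by
      rw [show (64 : ℝ) = 2 ^ 6 by norm_num, Real.log_pow]; push_cast; ring
    rw [this]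
    have := Real.log_two_lt_d9
    linarith
  have hlog54 : Real.log 54 < 4.16 :=
    lt_of_le_of_lt (Real.log_le_log (by norm_num) (by norm_num)) hlog64
  have hlog54nn : 0 ≤ Real.log 54 := Real.log_nonneg (by norm_num)
  -- the exponent count
  have hc0 : 0 < 4 / 3 - ε := by linarith
  have key : (4 / 3 - ε) * Real.log P ≤ Real.log (prattVal (ZMod P)) := by
    have h1 : (4 / 3 - ε) * Real.log P ≤ (4 / 3 - ε) * (Real.log 54 + 3 * ((2 + ε / 4) * Real.log n)) :=
      mul_le_mul_of_nonneg_left hlogP hc0.le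
    have h2 : (4 / 3 - ε) * Real.log 54 ≤ 4 / 3 * 4.16 := by
      have := mul_le_mul (show (4 / 3 - ε : ℝ) ≤ 4 / 3 by linarith) hlog54.le hlog54nn (by norm_num)
      linarith
    have h3 : (4 / 3 - ε) * (Real.log 54 + 3 * ((2 + ε / 4) * Real.log n)) =
        (4 / 3 - ε) * Real.log 54 + (8 - 5 * ε) * Real.log n - 3 / 4 * (ε * (ε * Real.log n)) := by
      ring
    have h4 : 0 ≤ ε * (ε * Real.log n) := by positivity
    have h5 : Real.log (Fintype.card ι₀) + 3 * ((2 - ε / 4) * Real.log n) =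
        Real.log (Fintype.card ι₀) + (6 - 3 / 4 * ε) * Real.log n := by ring
    nlinarith [hbig, hLpos, h1, h2, h3, h4, hlogV, hlogN, hlog64, mul_pos hε hLpos]
  calc (P : ℝ) ^ (4 / 3 - ε) = Real.exp (Real.log P * (4 / 3 - ε)) := Real.rpow_def_of_pos hPpos _
    _ ≤ Real.exp (Real.log (prattVal (ZMod P))) := Real.exp_le_exp.2 (by rw [mul_comm]; exact key)
    _ = (prattVal (ZMod P) : ℝ) := Real.exp_log hVpos

/-- **The crux forces `Val(ℤ/P) ≥ P^{4/3-ε}` at infinitely many PRIMES `P`** (Pratt 2024 Thm 4.7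
at prime moduli, for prime-cyclic two families): CKSU §6 lift on a Behrend corner-free index set
(tree `addSimultaneousTPP_of_sdpp`, `exists_cornerFree_indexMaps_card_ge`), the tree's mixed-radix
Freiman map into any modulus `N ≥ (3p)³` (`sum_card_mul_le_prattVal_zmod_of_addEquiv`) and
Bertrand's postulate for a prime `P ∈ ((3p)³, 2(3p)³]`; exponent count
`(8 - ε)·log n - log 64 ≥ (4/3 - ε)(log 54 + (6 + 3ε/4) log n)` once `ε log n > 10`. -/
theorem exists_prime_prattVal_ge_of_primeTwoFamilies (hT : FourierTwoFamiliesModP.PrimeTwoFamilies)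
    (ε : ℝ) (hε : 0 < ε) (N₀ : ℕ) :
    ∃ P : ℕ, ∃ _ : NeZero P, P.Prime ∧ N₀ ≤ P ∧ (P : ℝ) ^ (4 / 3 - ε) ≤ (prattVal (ZMod P) : ℝ) := by
  obtain ⟨P, _inst, hP, hNP, hle⟩ :=
    exists_prime_prattVal_ge_aux hT (lt_min hε one_pos) (min_le_right _ _) N₀
  refine ⟨P, ‹_›, hP, hNP, le_trans ?_ hle⟩
  have hP1 : (1 : ℝ) ≤ P := by exact_mod_cast hP.one_lt.le
  exact Real.rpow_le_rpow_of_exponent_le hP1 (by have := min_le_left ε 1; linarith)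

/-- **Conditional kill #1 (the sibling route's 4/3 rung refutes the crux)**:
`EisensteinValCertificates.PrimeFourThirdsSaving` (stmt-MatrixMultiplication-7790: `∃ δ > 0, K` with
`#{a+b+c=0} ≤ K p^{4/3-δ}` for every equilateral-trapezoid-free `(A,B,C) ⊂ ℤ/p`, `p` prime) implies
`¬ PrimeTwoFamilies`.  (`Val(ℤ/P) ≤ K P^{4/3-δ}` at all primes versus `≥ P^{4/3-δ/2}` at infinitely
many.)  The formal version of the route's kill criterion "PrimeFourThirdsSaving + Pratt Thm 4.7"; note
that the tree fact `pratt2024_thm47` alone yields composite moduli only. -/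
theorem primeTwoFamilies_false_of_primeFourThirdsSaving
    (hV : EisensteinValCertificates.PrimeFourThirdsSaving) :
    ¬ FourierTwoFamiliesModP.PrimeTwoFamilies := by
  intro hT
  obtain ⟨δ, hδ, K, hK⟩ := hV
  have hVal : ∀ q : ℕ, [NeZero q] → q.Prime →
      (prattVal (ZMod q) : ℝ) ≤ K * (q : ℝ) ^ ((4 : ℝ) / 3 - δ) := by
    intro q _ hq
    obtain ⟨A, B, C, hfree, hcard⟩ := exists_prattVal_eq (G := ZMod q)
    have h := hK q hq A B C hfree
    rw [← hcard]
    simpa [zeroSumTriples] using h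
  set K' : ℝ := max K 1 with hK'
  have hK'1 : (1 : ℝ) ≤ K' := le_max_right _ _
  have hK'pos : (0 : ℝ) < K' := by linarith
  obtain ⟨P, _inst, hP, hNP, hle⟩ :=
    exists_prime_prattVal_ge_of_primeTwoFamilies hT (δ / 2) (by positivity) (⌈K' ^ (2 / δ)⌉₊ + 1)
  have hPpos : (0 : ℝ) < P := by exact_mod_cast hP.pos
  have hup : (prattVal (ZMod P) : ℝ) ≤ K' * (P : ℝ) ^ ((4 : ℝ) / 3 - δ) :=
    (hVal P hP).trans (mul_le_mul_of_nonneg_right (le_max_left _ _) (Real.rpow_nonneg hPpos.le _))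
  have h1 : (P : ℝ) ^ (4 / 3 - δ / 2) ≤ K' * (P : ℝ) ^ ((4 : ℝ) / 3 - δ) := hle.trans hup
  have h2 : (P : ℝ) ^ (δ / 2) ≤ K' := by
    have h3 : (P : ℝ) ^ (4 / 3 - δ / 2) = (P : ℝ) ^ (δ / 2) * (P : ℝ) ^ ((4 : ℝ) / 3 - δ) := by
      rw [← Real.rpow_add hPpos]; congr 1; ring
    rw [h3] at h1
    exact le_of_mul_le_mul_right h1 (Real.rpow_pos_of_pos hPpos _)
  have h4 : K' ^ (2 / δ) < (P : ℝ) := by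
    have h5 := Nat.le_ceil (K' ^ (2 / δ))
    have h6 : (⌈K' ^ (2 / δ)⌉₊ : ℝ) < P := by
      exact_mod_cast (show ⌈K' ^ (2 / δ)⌉₊ < P by omega)
    linarith
  have hδ0 : δ ≠ 0 := hδ.ne'
  have h7 : K' < (P : ℝ) ^ (δ / 2) := by
    have h8 := Real.rpow_lt_rpow (Real.rpow_nonneg hK'pos.le _) h4 (by positivity : (0:ℝ) < δ / 2)
    have h9 : (2 / δ * (δ / 2) : ℝ) = 1 := by field_simp
    rwa [← Real.rpow_mul hK'pos.le, h9, Real.rpow_one] at h8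
  linarith

/-- The crux implies the all-abelian two-families hypothesis of the tree fact `pratt2024_thm47`
(`H := ℤ/p`). -/
theorem twoFamiliesAbelian_of_primeTwoFamilies (hT : FourierTwoFamiliesModP.PrimeTwoFamilies) :
    ∀ δ : ℝ, 0 < δ → ∀ n₀ : ℕ, ∃ n ≥ n₀, ∃ (H : Type) (_ : AddCommGroup H) (_ : Fintype H)
      (A B : Fin n → Finset H),
      (∀ i : Fin n, ∀ a ∈ A i, ∀ a' ∈ A i, ∀ b ∈ B i, ∀ b' ∈ B i,
          (a - a') + (b - b') = 0 → a = a' ∧ b = b') ∧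
      (∀ i j k : Fin n, ∀ a ∈ A i, ∀ a' ∈ A j, ∀ b ∈ B j, ∀ b' ∈ B k,
          (a - a') + (b - b') = 0 → i = k) ∧
      (Fintype.card H : ℝ) ≤ (n : ℝ) ^ (2 + δ) ∧
      ∀ i : Fin n, (n : ℝ) ^ (2 - δ) ≤ (((A i).card * (B i).card : ℕ) : ℝ) := by
  intro δ hδ n₀
  obtain ⟨n, hn, p, hp, A, B, hW, hX, hpn, hAB⟩ := hT δ hδ n₀
  haveI : Fact p.Prime := ⟨hp⟩
  exact ⟨n, hn, ZMod p, inferInstance, inferInstance, A, B, hW, hX, by rwa [ZMod.card], hAB⟩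

/-- **Conditional kill #2 (any `4/3 - ε` saving on `Val` over ALL large moduli refutes the crux)**,
straight from the tree theorem `pratt2024_thm47_holds` (Pratt 2024 Thm 4.7, proved in tree). -/
theorem primeTwoFamilies_false_of_valSaving
    (hV : ∃ ε : ℝ, 0 < ε ∧ ∃ N₀ : ℕ, ∀ N : ℕ, N₀ ≤ N → ∀ [NeZero N],
      (prattVal (ZMod N) : ℝ) < (N : ℝ) ^ (4 / 3 - ε)) :
    ¬ FourierTwoFamiliesModP.PrimeTwoFamilies := by
  intro hT
  obtain ⟨ε, hε, N₀, hN⟩ := hV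
  obtain ⟨N, _inst, hN₀, hle⟩ :=
    pratt2024_thm47_holds (twoFamiliesAbelian_of_primeTwoFamilies hT) ε hε N₀
  exact absurd hle (not_le.2 (hN N hN₀))


end Summit.MatrixMultiplication.MatrixMultiplication.Theorems.PrimeTwoFamilies.Negative
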